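import Summits.NavierStokesRegularity.NavierStokesRegularity.Theorems.SheetLaws
import HarnessLib

/-!
# ROUND-21 (nsreg-p2, gen 23) — THE SHEET LAWS, Part 2/4: ADDENDUM 21A, the joint ledger `ζ = ω_θ/(rz)`

Landed for the planner seat nsreg-p2 (gen 23) by the prover seat nsreg-p4 (gen 14) as route-line
material of `SwirlThreshold` (`--supports stmt-NavierStokesRegularity-2002`): the text of the declarations is
VERBATIM the planner's companion `HOME/ns-regularity-ideate-p2/R21-SheetLaws.lean` (v8, sha16
e3c548b310767775), split into files of ≤ 400 lines (this file: §5 — `meridionalContrast`, `swirlFeed`, S-21.4 `MeridionalContrastMaxPrinciple` (support Prop), S-21.5 `OddClassDSSMeridionalLedger` PROVED from S-21.4, S-21.6 `OddClassSSPointwiseLaw` (form only)).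

WHAT THIS IS NOT: not a regularity criterion, not a claim about Hou's computation, not a proof of any
route item (see Part 1 for the mechanism, the hard-core line and the honesty flags).
-/

namespace Summit.NavierStokesRegularity.NavierStokesRegularity.Theorems.SheetLaws

open MeasureTheory Set Filter Topology Metric WithLp
open scoped ENNReal NNReal
open Literature.Analysis Literature.Analysis.FluidPDE

noncomputable section
/-! ## 5. ADDENDUM 21A — the joint ledger (`ζ = ω_θ/(rz)`) and the pointwise self-similar law

In the odd-swirl class `ω_θ` is odd in `z`, so the MERIDIONAL CONTRAST `ζ := ω_θ/(rz) = η/z`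
(scaling dimension `-4`) is smooth and solves (kit j285851 [A6], sympy residual `0`)
`∂_t ζ + u·∇ζ + (u_z/z) ζ = ν(∂_r² + 3r⁻¹∂_r + ∂_z² + 2z⁻¹∂_z) ζ + 2χ ∂_zΓ / r⁴`:
the SAME compression potential `u_z/z` as `χ`, plus the swirl feed `2χ∂_zΓ/r⁴` (on the sheet
`2χ₀²/r⁴ ≥ 0`; the funnel's sheet toll `τ_N = 24P(P+1)/r⁶` is the sheet trace of the steady
ζ-balance).  For a `λ`-DSS blow-up `sup|ζ|` is multiplied by `λ⁴` per period, so compression and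
swirl feed together owe `4 ln λ` per period (`OddClassDSSMeridionalLedger`), while compression alone
already owes `ln λ` to `χ` (`OddClassDSSCompressionLaw`).  For an exactly self-similar blow-up the
χ-law is POINTWISE: where `|χ(t,·)|` peaks, `-u_z/z ≥ 1/(2(T-t))` (`OddClassSSPointwiseLaw`). -/

/-- **The meridional contrast** `ζ = ω_θ/(r z) = (x₀ ω₁ - x₁ ω₀)/((x₀²+x₁²) x₂)`, `ω = curl v`
(junk `0` on the axis and on the sheet). -/
def meridionalContrast (v : EuclideanSpace ℝ (Fin 3) → EuclideanSpace ℝ (Fin 3))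
    (x : EuclideanSpace ℝ (Fin 3)) : ℝ :=
  swirl (curl v) x / ((x 0 ^ 2 + x 1 ^ 2) * x 2)

/-- **The swirl feed of the meridional contrast**, `2 χ ∂_zΓ / r⁴` (`∂_zΓ` = the derivative of
`Γ = swirl v` in the direction `e₂`; junk `0` on the axis). On the sheet it equals `2χ₀²/r⁴ ≥ 0`. -/
def swirlFeed (v : EuclideanSpace ℝ (Fin 3) → EuclideanSpace ℝ (Fin 3))
    (x : EuclideanSpace ℝ (Fin 3)) : ℝ :=
  2 * oddContrast v x * fderiv ℝ (swirl v) x (EuclideanSpace.single 2 1) / (x 0 ^ 2 + x 1 ^ 2) ^ 2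

/-- The vorticity has scaling dimension `-2`: `curl (c·v(c·)) x = c² · (curl v)(c x)` (chain rule,
no differentiability hypothesis: the tree's `fderiv_smul_comp_smul` and `curl_eq_curlCLM`). -/
theorem curl_rescale (c : ℝ) (v : EuclideanSpace ℝ (Fin 3) → EuclideanSpace ℝ (Fin 3))
    (x : EuclideanSpace ℝ (Fin 3)) :
    curl (fun y => c • v (c • y)) x = c ^ 2 • curl v (c • x) := by
  rw [curl_eq_curlCLM, curl_eq_curlCLM, fderiv_smul_comp_smul, map_smul]

/-- `ζ` has scaling dimension `-4`: `ζ[c·v(c·)](x) = c⁴ · ζ[v](c x)` (`c ≠ 0`). -/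
theorem meridionalContrast_rescale {c : ℝ} (hc : c ≠ 0)
    (v : EuclideanSpace ℝ (Fin 3) → EuclideanSpace ℝ (Fin 3)) (x : EuclideanSpace ℝ (Fin 3)) :
    meridionalContrast (fun y => c • v (c • y)) x = c ^ 4 * meridionalContrast v (c • x) := by
  unfold meridionalContrast
  have h1 : swirl (curl fun y => c • v (c • y)) x = c * swirl (curl v) (c • x) := by
    have h2 : (curl fun y => c • v (c • y)) = fun y => c ^ 2 • curl v (c • y) := by
      funext y; exact curl_rescale c v y
    rw [h2]
    simp only [swirl, PiLp.smul_apply, smul_eq_mul]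
    ring
  rw [h1]
  simp only [PiLp.smul_apply, smul_eq_mul]
  by_cases hx : (x 0 ^ 2 + x 1 ^ 2) * x 2 = 0
  · have hx' : ((c * x 0) ^ 2 + (c * x 1) ^ 2) * (c * x 2) = 0 := by
      have : ((c * x 0) ^ 2 + (c * x 1) ^ 2) * (c * x 2) = c ^ 3 * ((x 0 ^ 2 + x 1 ^ 2) * x 2) := by
        ring
      rw [this, hx, mul_zero]
    rw [hx, hx', div_zero, div_zero, mul_zero]
  · have hx' : ((c * x 0) ^ 2 + (c * x 1) ^ 2) * (c * x 2) ≠ 0 := by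
      have : ((c * x 0) ^ 2 + (c * x 1) ^ 2) * (c * x 2) = c ^ 3 * ((x 0 ^ 2 + x 1 ^ 2) * x 2) := by
        ring
      rw [this]; exact mul_ne_zero (pow_ne_zero 3 hc) hx
    field_simp

/-- **MERIDIONAL-CONTRAST MAXIMUM PRINCIPLE WITH SWIRL FEED** (support statement; the parabolic
maximum principle / Grönwall for [A6]): in the odd-swirl class on `[s,t]`, with `ζ` decaying at
spatial infinity uniformly on `[s,t]`, a NONNEGATIVE majorant `k` of the compression `-u_z/z` and a
majorant `σ` of the swirl feed `|2χ∂_zΓ/r⁴|`,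
`|ζ(t,x)| ≤ (C₀ + ∫_s^t σ) · exp(∫_s^t k)` whenever `|ζ(s,·)| ≤ C₀`. -/
def MeridionalContrastMaxPrinciple : Prop :=
  ∀ (S : Set ℝ) (ν : ℝ), 0 < ν →
  ∀ (u : ℝ → EuclideanSpace ℝ (Fin 3) → EuclideanSpace ℝ (Fin 3))
    (p : ℝ → EuclideanSpace ℝ (Fin 3) → ℝ), IsClassicalNSSolutionOn S ν 0 u p →
  ∀ (s t : ℝ), s ≤ t → Icc s t ⊆ S →
    (∀ τ ∈ Icc s t, IsAxisymmetric (u τ) ∧ IsOddSwirlClass (u τ)) →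
    (∀ ε : ℝ, 0 < ε → ∃ R : ℝ, ∀ τ ∈ Icc s t, ∀ x : EuclideanSpace ℝ (Fin 3),
        R ≤ ‖x‖ → |meridionalContrast (u τ) x| ≤ ε) →
    ∀ (C₀ : ℝ) (k σ : ℝ → ℝ),
      (∀ x, |meridionalContrast (u s) x| ≤ C₀) →
      (∀ τ ∈ Icc s t, 0 ≤ k τ) →
      (∀ τ ∈ Icc s t, ∀ x : EuclideanSpace ℝ (Fin 3), x 2 ≠ 0 → sheetCompression (u τ) x ≤ k τ) →
      (∀ τ ∈ Icc s t, ∀ x : EuclideanSpace ℝ (Fin 3), |swirlFeed (u τ) x| ≤ σ τ) →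
      ContinuousOn k (Icc s t) → ContinuousOn σ (Icc s t) →
      ∀ x, |meridionalContrast (u t) x| ≤ (C₀ + ∫ τ in s..t, σ τ) * Real.exp (∫ τ in s..t, k τ)

/-- **Four periods' worth**: `0 < m`, `0 ≤ Sg`, `λ⁴ m ≤ (m + Sg) e^K ⇒ 4 ln λ ≤ K + ln(1 + Sg/m)`. -/
theorem four_log_le_budget {m lam K Sg : ℝ} (hm : 0 < m) (hl : 0 < lam) (hSg : 0 ≤ Sg)
    (h : lam ^ 4 * m ≤ (m + Sg) * Real.exp K) :
    4 * Real.log lam ≤ K + Real.log (1 + Sg / m) := by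
  have h1 : lam ^ 4 ≤ (1 + Sg / m) * Real.exp K := by
    have h' : lam ^ 4 * m ≤ (1 + Sg / m) * Real.exp K * m := by
      have : (1 + Sg / m) * Real.exp K * m = (m + Sg) * Real.exp K := by
        field_simp
      linarith [this]
    exact le_of_mul_le_mul_right h' hm
  have hpos : 0 < 1 + Sg / m := by positivity
  calc 4 * Real.log lam = Real.log (lam ^ 4) := by rw [Real.log_pow]; norm_num
    _ ≤ Real.log ((1 + Sg / m) * Real.exp K) := Real.log_le_log (by positivity) h1
    _ = K + Real.log (1 + Sg / m) := by
        rw [Real.log_mul hpos.ne' (Real.exp_pos K).ne', Real.log_exp]; ring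

/-- **ODD-CLASS DSS MERIDIONAL LEDGER.**  For a `λ`-DSS classical solution on `(-∞,0)` in the
odd-swirl class (decaying, `ζ(-λ²,·)` bounded and not identically zero), every nonnegative
majorant `k` of the compression and every majorant `σ` of the swirl feed on the period
`[-λ², -1]` satisfy `4 ln λ ≤ ∫k + ln(1 + ∫σ / sup|ζ(-λ²,·)|)`: compression and swirl feed
together must supply the factor `λ⁴` by which the meridional contrast grows per period.  Either the
flow compresses toward its sheet at dimensionless rate `≥ 2` on average (four times the χ-minimum of
`OddClassDSSCompressionLaw`), or the swirl pays the meridional contrast — the blow-up form of the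
funnel's sheet toll. -/
def OddClassDSSMeridionalLedger : Prop :=
  ∀ (lam ν : ℝ), 1 < lam → 0 < ν →
  ∀ (u : ℝ → EuclideanSpace ℝ (Fin 3) → EuclideanSpace ℝ (Fin 3))
    (p : ℝ → EuclideanSpace ℝ (Fin 3) → ℝ),
    IsClassicalNSSolutionOn (Iio 0) ν 0 u p → IsDiscretelySelfSimilar lam u →
    (∀ τ ∈ Icc (-lam ^ 2) (-1), IsAxisymmetric (u τ) ∧ IsOddSwirlClass (u τ)) →
    (∀ ε : ℝ, 0 < ε → ∃ R : ℝ, ∀ τ ∈ Icc (-lam ^ 2) (-1), ∀ x : EuclideanSpace ℝ (Fin 3),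
        R ≤ ‖x‖ → |meridionalContrast (u τ) x| ≤ ε) →
    BddAbove (range fun x => |meridionalContrast (u (-lam ^ 2)) x|) →
    (∃ x, meridionalContrast (u (-lam ^ 2)) x ≠ 0) →
    ∀ k σ : ℝ → ℝ,
      (∀ τ ∈ Icc (-lam ^ 2) (-1), 0 ≤ k τ) →
      (∀ τ ∈ Icc (-lam ^ 2) (-1), ∀ x : EuclideanSpace ℝ (Fin 3), x 2 ≠ 0 →
          sheetCompression (u τ) x ≤ k τ) →
      (∀ τ ∈ Icc (-lam ^ 2) (-1), ∀ x : EuclideanSpace ℝ (Fin 3), |swirlFeed (u τ) x| ≤ σ τ) →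
      ContinuousOn k (Icc (-lam ^ 2) (-1)) → ContinuousOn σ (Icc (-lam ^ 2) (-1)) →
      4 * Real.log lam ≤ (∫ τ in (-lam ^ 2)..(-1), k τ) +
        Real.log (1 + (∫ τ in (-lam ^ 2)..(-1), σ τ) / ⨆ x, |meridionalContrast (u (-lam ^ 2)) x|)

/-- **The meridional ledger follows from its maximum principle** (proved: `ζ` scaling covariance
`meridionalContrast_rescale` + `MeridionalContrastMaxPrinciple` over one period +
`four_log_le_budget`). -/
theorem oddClassDSSMeridionalLedger_of_maxPrinciple (hMP : MeridionalContrastMaxPrinciple) :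
    OddClassDSSMeridionalLedger := by
  intro lam ν hlam hν u p hsol hdss hsym hdec hbdd hnz k σ hk0 hk hσ hint hintσ
  have hl0 : 0 < lam := by linarith
  have hst : -lam ^ 2 ≤ (-1 : ℝ) := by nlinarith
  have hsub : Icc (-lam ^ 2) (-1 : ℝ) ⊆ Iio 0 := fun τ hτ => lt_of_le_of_lt hτ.2 (by norm_num)
  set m : ℝ := ⨆ x, |meridionalContrast (u (-lam ^ 2)) x| with hm_def
  have hm_le : ∀ x, |meridionalContrast (u (-lam ^ 2)) x| ≤ m := fun x =>
    le_ciSup (f := fun x => |meridionalContrast (u (-lam ^ 2)) x|) hbdd x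
  have hmax := hMP (Iio 0) ν hν u p hsol (-lam ^ 2) (-1) hst hsub hsym hdec m k σ hm_le hk0 hk hσ
    hint hintσ
  have hscale : ∀ x, meridionalContrast (u (-1)) x =
      lam ^ 4 * meridionalContrast (u (-lam ^ 2)) (lam • x) := by
    intro x
    have hfun : u (-1) = fun y => lam • u (-lam ^ 2) (lam • y) := by
      funext y
      have h1 := congrFun (congrFun hdss (-1)) y
      rw [nsRescale_apply] at h1
      rw [← h1]
      congr 1
      ring_nf
    rw [hfun]
    exact meridionalContrast_rescale hl0.ne' _ _
  obtain ⟨x₀, hx₀⟩ := hnz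
  have hm_pos : 0 < m := lt_of_lt_of_le (abs_pos.mpr hx₀) (hm_le x₀)
  set Sg : ℝ := ∫ τ in (-lam ^ 2)..(-1), σ τ with hSg_def
  set K : ℝ := ∫ τ in (-lam ^ 2)..(-1), k τ with hK_def
  have hSg0 : 0 ≤ Sg := by
    rw [hSg_def]
    apply intervalIntegral.integral_nonneg hst
    intro τ hτ
    exact le_trans (abs_nonneg _) (hσ τ hτ 0)
  have hkey : ∀ x, lam ^ 4 * |meridionalContrast (u (-lam ^ 2)) x| ≤ (m + Sg) * Real.exp K := by
    intro x
    have h1 := hmax (lam⁻¹ • x)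
    rw [hscale, smul_smul, mul_inv_cancel₀ hl0.ne', one_smul, abs_mul,
      abs_of_pos (by positivity : (0:ℝ) < lam ^ 4)] at h1
    exact h1
  have hl4 : 0 < lam ^ 4 := by positivity
  have hsup : lam ^ 4 * m ≤ (m + Sg) * Real.exp K := by
    have h2 : ∀ x, |meridionalContrast (u (-lam ^ 2)) x| ≤ (m + Sg) * Real.exp K / lam ^ 4 := by
      intro x
      rw [le_div_iff₀ hl4, mul_comm]
      exact hkey x
    have h3 : m ≤ (m + Sg) * Real.exp K / lam ^ 4 := ciSup_le h2
    rwa [le_div_iff₀ hl4, mul_comm] at h3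
  exact four_log_le_budget hm_pos hl0 hSg0 hsup

/-- **ODD-CLASS SELF-SIMILAR POINTWISE LAW** (support statement; the maximum principle for the
profile equation `½X + ½y·∇X + U·∇X + (U_z/y_z)X = νM_yX` of `χ = (-t)^{-1/2}X(x/√(-t))` at a
maximum point of `|X|`): for an exactly self-similar blow-up (at `t = 0`) in the odd-swirl class,
at every point `x*` where `|χ(t,·)|` attains a nonzero maximum the fluid falls toward the symmetry
plane at least at half the self-similar rate: `-u_z(t,x*)/x*_z ≥ 1/(2(-t))`.  HONESTY CLAUSE: for
BOUNDED profiles the class is empty (Tsai 1998, Thm 1, `q = ∞`; tree facts `tsai_selfsimilar`,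
`necas_ruzicka_sverak`, barrier `LeraySelfSimilarBlowupExclusion`) — the statement records the FORM
of the compression law in the self-similar idealisation; the rigorous DSS statement is the
period average `OddClassDSSCompressionLaw`. -/
def OddClassSSPointwiseLaw : Prop :=
  ∀ (ν : ℝ), 0 < ν →
  ∀ (u : ℝ → EuclideanSpace ℝ (Fin 3) → EuclideanSpace ℝ (Fin 3))
    (p : ℝ → EuclideanSpace ℝ (Fin 3) → ℝ),
    IsClassicalNSSolutionOn (Iio 0) ν 0 u p → IsSelfSimilar u →
    (∀ τ < 0, IsAxisymmetric (u τ) ∧ IsOddSwirlClass (u τ)) →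
    ∀ t < 0, ∀ xs : EuclideanSpace ℝ (Fin 3),
      (∀ y, |oddContrast (u t) y| ≤ |oddContrast (u t) xs|) → oddContrast (u t) xs ≠ 0 →
      1 / (2 * (-t)) ≤ sheetCompression (u t) xs

end

end Summit.NavierStokesRegularity.NavierStokesRegularity.Theorems.SheetLaws
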